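import Mathlib
import HarnessLib
import Summits.NavierStokesRegularity.NavierStokesRegularity.Theorems.TaylorModelRungThreeSoundnessVectorDeriv

/-!
# Line `taylor-model` on crux K1b-DR (`ExactWindowRungThree.DerivativeEnclosureCertificateR`,
# stmt-NavierStokesRegularity-23954) — VECTOR STEP LEMMA, part 9: FRÉCHET differentiability of the flow map
# within a start set, no step restriction (chain rules across sub-steps for the C¹ read-outs)

Upgrade of part 4 (segment derivatives) to a Fréchet derivative WITHIN the start set `S`: if every trajectory
from `S` exists on `[0,t]` with a common norm bound, and the variational equation along the trajectory from `x`
has solutions `W c` from the scaled basis directions `r c • e_c` (`0 < r c`; the K-side certifies them by the pair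
test of part 3/5 for a direction box around `0`), then `y ↦ ψ y t` has, within `S` at `x`, the Fréchet derivative
`L z := Σ_c (z c / r c) • W c t` — an explicit continuous linear map, so NO uniqueness or choice is needed, and
Mathlib's `HasFDerivWithinAt.comp` chains sub-steps (node sets map into node sets).

* `hasFDerivWithinAt_flow` — the general statement (two Grönwall estimates, as in part 4);
* `hasFDerivWithinAt_flowSel` — `Fin n` / `flowSel` corollary under the first-order tests of parts 1/3
  ((E1) for the start box `S = [slo, shi] ⊆ [lo, hi]`, (V1) for the direction box).

MODEL-lattice bookkeeping only (rung TL-M3 of the NS ladder: one finite-dimensional model ODE); nothing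
here is a statement about the Navier–Stokes equations.
-/

noncomputable section

-- the sub-problem namespace repeats the summit name by design (D-0017)
set_option linter.dupNamespace false

namespace Summit.NavierStokesRegularity.NavierStokesRegularity.Theorems.TaylorModelVector

open scoped BigOperators Topology
open Set Filter Metric Asymptotics

section General

variable {ι : Type*} [Fintype ι] [DecidableEq ι]
  (Q : (ι → ℝ) →ₗ[ℝ] (ι → ℝ) →ₗ[ℝ] ι → ℝ)

/-- **FRÉCHET DIFFERENTIABILITY OF THE FLOW MAP WITHIN A START SET (no step restriction).** Let `ψ y`
(`y ∈ S`) solve `u' = Q(u,u)` on `[0,t]` from `y`, all of norm `≤ R`; let `x ∈ S` and let `W c` (`c : ι`) solve the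
variational equation along `ψ x` from `r c • Pi.single c 1`, `0 < r c`.  Then `y ↦ ψ y t` has the Fréchet
derivative `z ↦ Σ_c (z c / r c) • W c t` within `S` at `x`. [folklore] -/
theorem hasFDerivWithinAt_flow {S : Set (ι → ℝ)} {x : ι → ℝ} (hx : x ∈ S) {t R : ℝ} (ht : 0 ≤ t)
    {ψ : (ι → ℝ) → ℝ → ι → ℝ} (hψ0 : ∀ y ∈ S, ψ y 0 = y)
    (hψ : ∀ y ∈ S, ∀ s ∈ Icc 0 t, HasDerivWithinAt (ψ y) (Q (ψ y s) (ψ y s)) (Icc 0 t) s)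
    (hR : ∀ y ∈ S, ∀ s ∈ Icc 0 t, ‖ψ y s‖ ≤ R) {r : ι → ℝ} (hr : ∀ c, 0 < r c)
    {W : ι → ℝ → ι → ℝ} (hW0 : ∀ c, W c 0 = r c • Pi.single c 1)
    (hW : ∀ c, ∀ s ∈ Icc 0 t, HasDerivWithinAt (W c) (Q (ψ x s) (W c s) + Q (W c s) (ψ x s)) (Icc 0 t) s) :
    HasFDerivWithinAt (fun y => ψ y t)
      (∑ c, (ContinuousLinearMap.proj c : (ι → ℝ) →L[ℝ] ℝ).smulRight ((r c)⁻¹ • W c t)) S x := by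
  obtain ⟨C, hC0, hC⟩ := exists_norm_Q_le Q
  have ht' : t ∈ Icc 0 t := ⟨ht, le_rfl⟩
  have hR0 : 0 ≤ R := (norm_nonneg _).trans (hR x hx 0 ⟨le_rfl, ht⟩)
  set K : ℝ := 2 * C * R with hK
  have hK0 : 0 ≤ K := by positivity
  have hL := lipschitzOnWith_quad Q hC0 hC hR0
  have hnhds : ∀ s ∈ Ico (0:ℝ) t, Icc 0 t ∈ 𝓝[≥] s := fun s hs =>
    mem_of_superset (Icc_mem_nhdsGE hs.2) (Icc_subset_Icc_left hs.1)
  -- the linear combination of the basis variations: `Vd d s = Σ_c (d c / r c) • W c s`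
  set Vd : (ι → ℝ) → ℝ → ι → ℝ := fun d s => ∑ c, (d c * (r c)⁻¹) • W c s with hVd
  have hVd0 : ∀ d, Vd d 0 = d := by
    intro d
    simp only [hVd, hW0, smul_smul]
    funext c'
    rw [Finset.sum_apply, Finset.sum_eq_single c' (fun c _ hc => by simp [Pi.single_eq_of_ne (Ne.symm hc)])
      (fun h => absurd (Finset.mem_univ c') h)]
    simp [(hr c').ne']
  have hVdder : ∀ d, ∀ s ∈ Icc 0 t,
      HasDerivWithinAt (Vd d) (Q (ψ x s) (Vd d s) + Q (Vd d s) (ψ x s)) (Icc 0 t) s := by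
    intro d s hs
    have h1 : HasDerivWithinAt (Vd d)
        (∑ c, (d c * (r c)⁻¹) • (Q (ψ x s) (W c s) + Q (W c s) (ψ x s))) (Icc 0 t) s := by
      simp only [hVd]
      refine HasDerivWithinAt.fun_sum fun c _ => ?_
      have h2 := (hW c s hs).const_smul (d c * (r c)⁻¹)
      exact h2
    refine h1.congr_deriv ?_
    simp only [hVd, map_sum, map_smul, LinearMap.sum_apply, LinearMap.smul_apply, smul_add,
      Finset.sum_add_distrib]
  have hLd : ∀ d, (∑ c, (ContinuousLinearMap.proj c : (ι → ℝ) →L[ℝ] ℝ).smulRight ((r c)⁻¹ • W c t)) d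
      = Vd d t := by
    intro d
    simp only [hVd, _root_.sum_apply, ContinuousLinearMap.smulRight_apply, ContinuousLinearMap.proj_apply,
      smul_smul]
  -- Step 1: Lipschitz dependence on the start point
  set M₁ : ℝ := Real.exp (K * t) with hM₁
  have step1 : ∀ y ∈ S, ∀ s ∈ Icc 0 t, ‖ψ y s - ψ x s‖ ≤ ‖y - x‖ * M₁ := by
    intro y hy s hs
    have hcont : ContinuousOn (fun σ => ψ y σ - ψ x σ) (Icc 0 t) := fun σ hσ =>
      ((hψ y hy σ hσ).sub (hψ x hx σ hσ)).continuousWithinAt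
    have hder : ∀ σ ∈ Ico 0 t, HasDerivWithinAt (fun σ => ψ y σ - ψ x σ)
        (Q (ψ y σ) (ψ y σ) - Q (ψ x σ) (ψ x σ)) (Ici σ) σ := fun σ hσ =>
      ((hψ y hy σ (Ico_subset_Icc_self hσ)).sub
        (hψ x hx σ (Ico_subset_Icc_self hσ))).mono_of_mem_nhdsWithin (hnhds σ hσ)
    have h0 : ‖ψ y 0 - ψ x 0‖ ≤ ‖y - x‖ := by rw [hψ0 y hy, hψ0 x hx]
    have hbound : ∀ σ ∈ Ico 0 t,
        ‖Q (ψ y σ) (ψ y σ) - Q (ψ x σ) (ψ x σ)‖ ≤ K * ‖ψ y σ - ψ x σ‖ + 0 := by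
      intro σ hσ
      have h1 := hL.norm_sub_le (mem_closedBall_zero_iff.2 (hR y hy σ (Ico_subset_Icc_self hσ)))
        (mem_closedBall_zero_iff.2 (hR x hx σ (Ico_subset_Icc_self hσ)))
      rw [Real.coe_toNNReal _ (by positivity)] at h1
      rw [add_zero, hK]
      exact h1
    have G := norm_le_gronwallBound_of_norm_deriv_right_le hcont hder h0 hbound s hs
    rw [gronwallBound_ε0, sub_zero] at G
    calc ‖ψ y s - ψ x s‖ ≤ ‖y - x‖ * Real.exp (K * s) := G
      _ ≤ ‖y - x‖ * Real.exp (K * t) := by gcongr; exact hs.2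
  -- Step 2: quadratic remainder of the linearisation
  set M₂ : ℝ := gronwallBound 0 K (C * M₁ ^ 2) t with hM₂
  have step2 : ∀ y ∈ S, ‖ψ y t - ψ x t - Vd (y - x) t‖ ≤ ‖y - x‖ ^ 2 * M₂ := by
    intro y hy
    set d := y - x with hd
    have hcont : ContinuousOn (fun σ => ψ y σ - ψ x σ - Vd d σ) (Icc 0 t) := fun σ hσ =>
      (((hψ y hy σ hσ).sub (hψ x hx σ hσ)).sub (hVdder d σ hσ)).continuousWithinAt
    have hder : ∀ σ ∈ Ico 0 t, HasDerivWithinAt (fun σ => ψ y σ - ψ x σ - Vd d σ)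
        (Q (ψ y σ) (ψ y σ) - Q (ψ x σ) (ψ x σ) - (Q (ψ x σ) (Vd d σ) + Q (Vd d σ) (ψ x σ))) (Ici σ) σ :=
      fun σ hσ => (((hψ y hy σ (Ico_subset_Icc_self hσ)).sub (hψ x hx σ (Ico_subset_Icc_self hσ))).sub
        (hVdder d σ (Ico_subset_Icc_self hσ))).mono_of_mem_nhdsWithin (hnhds σ hσ)
    have h0 : ‖ψ y 0 - ψ x 0 - Vd d 0‖ ≤ 0 := by
      rw [hψ0 y hy, hψ0 x hx, hVd0, hd, sub_self, norm_zero]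
    have hbound : ∀ σ ∈ Ico 0 t,
        ‖Q (ψ y σ) (ψ y σ) - Q (ψ x σ) (ψ x σ) - (Q (ψ x σ) (Vd d σ) + Q (Vd d σ) (ψ x σ))‖
          ≤ K * ‖ψ y σ - ψ x σ - Vd d σ‖ + C * M₁ ^ 2 * ‖y - x‖ ^ 2 := by
      intro σ hσ
      have alg := quad_lin_defect Q (ψ x σ) (ψ y σ - ψ x σ) (Vd d σ) 1
      rw [add_sub_cancel, one_smul, one_smul] at alg
      rw [alg]
      have na : ‖ψ x σ‖ ≤ R := hR x hx σ (Ico_subset_Icc_self hσ)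
      have nd : ‖ψ y σ - ψ x σ‖ ≤ ‖y - x‖ * M₁ := step1 y hy σ (Ico_subset_Icc_self hσ)
      calc ‖Q (ψ x σ) (ψ y σ - ψ x σ - Vd d σ) + Q (ψ y σ - ψ x σ - Vd d σ) (ψ x σ)
            + Q (ψ y σ - ψ x σ) (ψ y σ - ψ x σ)‖
          ≤ ‖Q (ψ x σ) (ψ y σ - ψ x σ - Vd d σ)‖ + ‖Q (ψ y σ - ψ x σ - Vd d σ) (ψ x σ)‖
            + ‖Q (ψ y σ - ψ x σ) (ψ y σ - ψ x σ)‖ := norm_add₃_le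
        _ ≤ C * ‖ψ x σ‖ * ‖ψ y σ - ψ x σ - Vd d σ‖ + C * ‖ψ y σ - ψ x σ - Vd d σ‖ * ‖ψ x σ‖
            + C * ‖ψ y σ - ψ x σ‖ * ‖ψ y σ - ψ x σ‖ :=
            add_le_add (add_le_add (hC _ _) (hC _ _)) (hC _ _)
        _ ≤ C * R * ‖ψ y σ - ψ x σ - Vd d σ‖ + C * ‖ψ y σ - ψ x σ - Vd d σ‖ * R
            + C * (‖y - x‖ * M₁) * (‖y - x‖ * M₁) := by gcongr
        _ = K * ‖ψ y σ - ψ x σ - Vd d σ‖ + C * M₁ ^ 2 * ‖y - x‖ ^ 2 := by rw [hK]; ring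
    have G := norm_le_gronwallBound_of_norm_deriv_right_le hcont hder h0 hbound t ht'
    rw [sub_zero, show C * M₁ ^ 2 * ‖y - x‖ ^ 2 = ‖y - x‖ ^ 2 * (C * M₁ ^ 2) by ring,
      gronwallBound_zero_mul] at G
    exact G
  -- Step 3: `O(‖y−x‖²) = o(y−x)`
  rw [hasFDerivWithinAt_iff_isLittleO]
  have big : (fun y => ψ y t - ψ x t -
      (∑ c, (ContinuousLinearMap.proj c : (ι → ℝ) →L[ℝ] ℝ).smulRight ((r c)⁻¹ • W c t)) (y - x))
        =O[𝓝[S] x] fun y => ‖y - x‖ ^ 2 := by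
    refine IsBigO.of_bound M₂ ?_
    filter_upwards [self_mem_nhdsWithin] with y hy
    rw [hLd, norm_pow, norm_norm, mul_comm]
    exact step2 y hy
  exact big.trans_isLittleO ((isLittleO_pow_sub_sub x one_lt_two).mono nhdsWithin_le_nhds)

end General

/-! ### `Fin n` corollary: the Fréchet derivative of the selector within the start box -/

section Majorant

open Summit.NavierStokesRegularity.NavierStokesRegularity.Theorems.TaylorModelMajorant

variable {n : ℕ} {Q : (Fin n → ℝ) → (Fin n → ℝ) → Fin n → ℝ} {w : Fin n → ℝ} {b : ℝ}
  {T : (Fin n → ℝ) → ℕ → Fin n → ℝ} {U : (Fin n → ℝ) → (Fin n → ℝ) → ℕ → Fin n → ℝ}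

/-- **Fréchet derivative of `y ↦ flowSel Q y t` within the start box `[slo,shi]`** (no step restriction): every
start point of `[slo,shi]` passes the first-order test for the box `[lo,hi]` on `[0,h]`; the direction box
`[loV,hiV]` passes the variational test for every start direction `r c • e_c` (`0 < r c`,
`r c • e_c ∈ [loV₀,hiV₀]`); then at every `x ∈ [slo,shi]` and `t ∈ [0,h]` there are basis variations `W c` along
`flowSel Q x` (confined to `[loV,hiV]`) and `HasFDerivWithinAt (fun y => flowSel Q y t) (z ↦ Σ_c (z c / r c) • W c t)
[slo,shi] x`. [folklore] -/
theorem hasFDerivWithinAt_flowSel (hS : IsMajorantSystem n Q w b T U)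
    {lo hi slo shi loV hiV loV₀ hiV₀ : Fin n → ℝ} {h : ℝ} (hh : 0 ≤ h) (hS' : Icc slo shi ⊆ Icc lo hi)
    (henc : ∀ x₀ ∈ Icc slo shi, ∀ y ∈ Icc lo hi, ∀ u ∈ Icc (0:ℝ) h, x₀ + u • Q y y ∈ Icc lo hi)
    (hV₀ : Icc loV₀ hiV₀ ⊆ Icc loV hiV)
    (hencV : ∀ v₀ ∈ Icc loV₀ hiV₀, ∀ y ∈ Icc lo hi, ∀ d ∈ Icc loV hiV, ∀ u ∈ Icc (0:ℝ) h,
      v₀ + u • (Q y d + Q d y) ∈ Icc loV hiV)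
    {r : Fin n → ℝ} (hr : ∀ c, 0 < r c) (hrD : ∀ c, r c • (Pi.single c 1 : Fin n → ℝ) ∈ Icc loV₀ hiV₀)
    {x : Fin n → ℝ} (hx : x ∈ Icc slo shi) {t : ℝ} (ht : t ∈ Icc 0 h) :
    ∃ W : Fin n → ℝ → Fin n → ℝ, (∀ c, W c 0 = r c • Pi.single c 1) ∧
      (∀ c, ∀ s ∈ Icc 0 h, HasDerivWithinAt (W c)
        (Q (flowSel Q x s) (W c s) + Q (W c s) (flowSel Q x s)) (Icc 0 h) s) ∧
      (∀ c, ∀ s ∈ Icc 0 h, W c s ∈ Icc loV hiV) ∧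
      HasFDerivWithinAt (fun y => flowSel Q y t)
        (∑ c, (ContinuousLinearMap.proj c : (Fin n → ℝ) →L[ℝ] ℝ).smulRight ((r c)⁻¹ • W c t))
        (Icc slo shi) x := by
  obtain ⟨Qb, hQb⟩ := exists_bundle hS
  -- basis variations along the trajectory from `x`, from the pair test
  have hpair : ∀ c, ∃ ψ₀ V : ℝ → Fin n → ℝ, ψ₀ 0 = x ∧ V 0 = r c • Pi.single c 1 ∧
      (∀ s ∈ Icc 0 h, HasDerivWithinAt ψ₀ (Qb (ψ₀ s) (ψ₀ s)) (Icc 0 h) s) ∧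
      (∀ s ∈ Icc 0 h, HasDerivWithinAt V (Qb (ψ₀ s) (V s) + Qb (V s) (ψ₀ s)) (Icc 0 h) s) ∧
      (∀ s ∈ Icc 0 h, ψ₀ s ∈ Icc lo hi) ∧ (∀ s ∈ Icc 0 h, V s ∈ Icc loV hiV) := by
    intro c
    refine exists_pair_sol_mem_Icc_of_roughEnclosure Qb (hS' hx) (hV₀ (hrD c)) hh ?_ ?_
    · simpa only [hQb] using henc x hx
    · simpa only [hQb] using hencV _ (hrD c)
  choose ψ₀ V hψ₀0 hV0 hψ₀der hVder hψ₀box hVbox using hpair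
  have hsol : ∀ c, IsSolOn Q x h (ψ₀ c) := fun c => ⟨hψ₀0 c, by simpa only [hQb] using hψ₀der c⟩
  have heq : ∀ c, ∀ s ∈ Icc 0 h, flowSel Q x s = ψ₀ c s := fun c s hs => hS.flowSel_eq (hsol c) hs
  have hVder' : ∀ c, ∀ s ∈ Icc 0 h, HasDerivWithinAt (V c)
      (Q (flowSel Q x s) (V c s) + Q (V c s) (flowSel Q x s)) (Icc 0 h) s := by
    intro c s hs
    rw [heq c s hs]
    simpa only [hQb] using hVder c s hs
  refine ⟨V, hV0, hVder', hVbox, ?_⟩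
  have hfam : ∀ y ∈ Icc slo shi, IsSolOn Q y h (fun s => flowSel Q y s) ∧
      ∀ s ∈ Icc 0 h, flowSel Q y s ∈ Icc lo hi :=
    fun y hy => flowSel_isSolOn_mem_Icc hS (hS' hy) hh (henc y hy)
  have hsub : Icc 0 t ⊆ Icc 0 h := Icc_subset_Icc_right ht.2
  refine hasFDerivWithinAt_flow Qb hx (R := max ‖lo‖ ‖hi‖) ht.1 (ψ := fun y s => flowSel Q y s)
    (fun y _ => flowSel_zero _) ?_ ?_ hr hV0 ?_
  · intro y hy s hs
    have h1 := (isSolOn_restrict (hfam y hy).1 ht).2 s hs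
    simpa only [hQb] using h1
  · exact fun y hy s hs => norm_le_of_mem_Icc ((hfam y hy).2 s (hsub hs))
  · intro c s hs
    have h1 := (hVder' c s (hsub hs)).mono hsub
    simpa only [hQb] using h1

end Majorant

end Summit.NavierStokesRegularity.NavierStokesRegularity.Theorems.TaylorModelVector

end
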